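import Literature.NumberTheory.Sieve.HeathBrownCubicTypeITools
import Literature.NumberTheory.LFunctions.MertensElementary
import Mathlib.Analysis.SpecificLimits.Normed
import Mathlib.FieldTheory.Finite.Basic
import HarnessLib

/-!
# The `ν`-weighted divisor sum over `ℤ[2^{1/3}]`: `∑_{N(I) ≤ x} τ(I)^c/ν(I) ≪ (log x)^{c'}` (core of Lemma 4.6)

Tool file (definitions with bodies + proofs, no named facts) in the decomposition of **Heath-Brown's
Type II estimate, Lemma 3.10** (`HeathBrown2001_lemma_3_10` of `HeathBrownCubicTypeII`), D. R.
Heath-Brown, *Primes represented by `x³ + 2y³`*, Acta Math. 186 (2001), 1–84, §4.  Lemma 4.7 there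
(`∑_{|m|≤x,|n|≤y} τ(m + n·2^{1/3})^A ≪ xy (log xy)^{c(A)}`, used in §11 for `E_V` and `S₁`) is "a corollary
of Lemma 4.6", whose proof (pp. 24–25) counts the pairs `m, n` with `I ∣ mα + nβ` through `ν(J)`, "the
smallest rational multiple of the ideal `J`", and then bounds the Dirichlet series
`f(σ) = ∑_I τ(I)^{(6r+5)A}/(ν(I₁)ν(I₂)N(I)^σ)` by an Euler product: "there are at most `(m+1)⁵` pairs
`I₁, I₂`, and `τ(I₁I₂) ≤ (m+1)³` for each pair … `N(I₁) ∣ ν(I₁)³` … It follows that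
`ν(I₁)ν(I₂) ≥ p^{m/3}`. We also have `ν(I₁)ν(I₂) ≥ p` for `m ≥ 1`. It therefore follows that
`e_{m,p} ≤ (m+1)⁵(18r+15)A min(p^{-m/3}, p^{-1})`, whence `1 + ∑ e_{m,p}p^{-mσ} ≤ 1 + c(A,r)p^{-1-σ}`".

This file PROVES the resulting bound for `α = 1` (the case of Lemma 4.7) in the finitary form

  `∑_{0 < N(I) ≤ N} τ(I)^c/ν(I) ≤ e^{8K} (log N)^{2K}`  (`N ≥ 2`, `K = K(c)`; `sum_nuWeight_le`),

without Dirichlet series: with `I_p` the `p`-primary part of `I`, `τ(I) ≤ ∏_p τ(I_p)` (Lemma 4.3) and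
`∏_p ν(I_p) ∣ ν(I)`, so `h(I) = τ(I)^c/ν(I) ≤ ∏_p h(I_p)`; the map `I ↦ (I_p)_{p ≤ N}` is injective, so
the sum is at most `∏_{p ≤ N} (∑_{N(J) = p^m ≤ N} h(J)) ≤ ∏_{p ≤ N} (1 + 2K/p)` by the printed local
count (`≤ (m+1)³` ideals of norm `p^m`, `τ ≤ (m+1)⁴`, `ν ≥ p·2^{m/3−1}`), and
`∏_{p ≤ N}(1 + 2K/p) ≤ exp(2K ∑_{p ≤ N} 1/p) ≤ exp(2K(log log N + 4))` by the tree's Mertens bound.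

## Content (namespace `Literature.NumberTheory.Sieve.CubicSieve`)

* `idealNu` (`ν(I)`, via the generator of `I ∩ ℤ`): `intCast_mem_iff_idealNu_dvd`, `idealNu_mem`,
  `idealNu_dvd_absNorm`, `idealNu_pos`, `absNorm_dvd_idealNu_pow` (`N(I) ∣ ν(I)³`),
  `idealNu_dvd_of_le`, `idealNu_top`;
* `underPrime`, `absNorm_eq_underPrime_pow` (norms of prime ideals are prime powers);
* `idealDivisorCount_finset_prod_le`, `finset_prod_dvd_of_coprime`, `pPart` (`I_p`), `pPart_dvd`,
  `pPart_ne_bot`, `exists_absNorm_pPart_eq_pow`, `pPart_eq_one_of_not_prime`, `prod_pPart_eq` (`I = ∏ I_p`),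
  `underPrime_le_absNorm`, `nuWeight` (`h`), **`nuWeight_le_prod`** (`h(I) ≤ ∏ h(I_p)`);
* `nuRatio` (`r = 2^{-1/3}`), `nuTerm`, `summable_nuTerm`, `nuConst` (`K(c) = ∑ (j+2)^{4c+3} r^{j+1}`),
  **`inv_idealNu_le`** (`1/ν(J) ≤ 2r^m/p` for `N(J) = p^m`), `sum_nuWeight_norm_eq_le`, `pPowerIdeals`,
  **`sum_pPowerIdeals_nuWeight_le`** (local factor `≤ 1 + 2K/p`);
* `pPart_mem_pPowerIdeals`, `sum_le_sum_of_injOn_nonneg`, `prod_one_add_le_exp_sum`,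
  **`sum_nuWeight_le`**, **`exists_sum_nuWeight_le`**.

## References

* D. R. Heath-Brown, *Primes represented by `x³ + 2y³`*, Acta Math. 186 (2001), 1–84: Lemma 4.6 and its
  proof, pp. 24–25. [cite: HeathBrownActa2001, Lemma 4.6]

## Mathlib / tree search

Mathlib: `Submodule.IsPrincipal.generator`, `Ideal.span_singleton_generator`, `Ideal.absNorm_mem`,
`Algebra.norm_algebraMap`, `NumberField.RingOfIntegers.rank`, `FiniteField.card'`,
`Ideal.finiteQuotientOfFreeOfNeBot`, `UniqueFactorizationMonoid.normalizedFactors`,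
`Ideal.prod_normalizedFactors_eq_self`, `Finset.prod_multiset_count`, `Finset.prod_fiberwise_of_maps_to`,
`Nat.coprime_pow_primes`, `ArithmeticFunction.sigma_zero_apply_prime_pow`,
`summable_pow_mul_geometric_of_norm_lt_one`, `Summable.sum_le_tsum`, `Finset.prod_univ_sum`, `Nat.primesLE`,
`Real.add_one_le_exp`; no `ν`, no divisor sums over number fields. Tree: `HeathBrownCubicTypeITools`
(`idealDivisorCount_mul_le` = Lemma 4.3, `one_le_idealDivisorCount`), `HeathBrownCubicSieveSetupProofs`
(`idealNormCount_le_sigma_zero_pow_three`, `idealDivisorCount_le_sigma_zero_pow_four`,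
`card_filter_absNorm_eq`), `HeathBrownCubicSieveSetup` (`idealsLE`, `idealDivisorCount`),
`Literature.NumberTheory.LFunctions.MertensBound.sum_inv_prime_le` (`MertensElementary`), `CubeRootTwoField`
(`finrank_K`).
-/

noncomputable section

open NumberField Finset UniqueFactorizationMonoid

open scoped ArithmeticFunction.sigma

namespace Literature.NumberTheory.Sieve.CubicSieve

open LFunctions.CubeRootTwoField

/-! ### `ν(I)`: the least positive rational integer in `I` -/

/-- `ν(I)`, "the smallest rational multiple of the ideal `I`" (p. 24): the positive generator of the
ideal `I ∩ ℤ` of `ℤ` (and `0` for `I = 0`). [cite: HeathBrownActa2001, §4 p. 24] -/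
def idealNu (I : Ideal (𝓞 K)) : ℕ :=
  (Submodule.IsPrincipal.generator (I.comap (algebraMap ℤ (𝓞 K)))).natAbs

/-- A rational integer `n` lies in `I` iff `ν(I) ∣ n`. [folklore] -/
theorem intCast_mem_iff_idealNu_dvd (I : Ideal (𝓞 K)) (n : ℤ) :
    (n : 𝓞 K) ∈ I ↔ (idealNu I : ℤ) ∣ n := by
  have h1 : (n : 𝓞 K) ∈ I ↔ n ∈ I.comap (algebraMap ℤ (𝓞 K)) := by
    rw [Ideal.mem_comap]; simp
  rw [h1, idealNu, Int.natAbs_dvd]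
  conv_lhs => rw [← Ideal.span_singleton_generator (I.comap (algebraMap ℤ (𝓞 K)))]
  exact Ideal.mem_span_singleton

/-- `ν(I) ∈ I`. [folklore] -/
theorem idealNu_mem (I : Ideal (𝓞 K)) : ((idealNu I : ℕ) : 𝓞 K) ∈ I := by
  have := (intCast_mem_iff_idealNu_dvd I (idealNu I)).mpr dvd_rfl
  rwa [Int.cast_natCast] at this

/-- `ν(I) ∣ N(I)` (as `N(I) ∈ I`). [folklore] -/
theorem idealNu_dvd_absNorm (I : Ideal (𝓞 K)) : idealNu I ∣ Ideal.absNorm I := by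
  have h : ((Ideal.absNorm I : ℤ) : 𝓞 K) ∈ I := by
    rw [Int.cast_natCast]; exact Ideal.absNorm_mem I
  have := (intCast_mem_iff_idealNu_dvd I _).mp h
  exact_mod_cast this

/-- `ν(I) ≥ 1` for `I ≠ 0`. [folklore] -/
theorem idealNu_pos {I : Ideal (𝓞 K)} (hI : I ≠ ⊥) : 0 < idealNu I := by
  rcases Nat.eq_zero_or_pos (idealNu I) with h0 | hpos
  · exfalso
    have h := idealNu_dvd_absNorm I
    rw [h0, zero_dvd_iff, Ideal.absNorm_eq_zero_iff] at h
    exact hI h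
  · exact hpos

/-- `N(I) ∣ ν(I)³` (as `I ∣ (ν(I))` and `N((q)) = q³`; the latter is also
`absNorm_span_natCast_K` of `HeathBrownCubicSiegelWalfisz`, not imported here). [folklore] -/
theorem absNorm_dvd_idealNu_pow (I : Ideal (𝓞 K)) : Ideal.absNorm I ∣ idealNu I ^ 3 := by
  have h : Ideal.span {((idealNu I : ℕ) : 𝓞 K)} ≤ I := by
    rw [Ideal.span_le, Set.singleton_subset_iff]; exact idealNu_mem I
  have := Ideal.absNorm_dvd_absNorm_of_le h
  have hq : Ideal.absNorm (Ideal.span {((idealNu I : ℕ) : 𝓞 K)}) = idealNu I ^ 3 := by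
    rw [Ideal.absNorm_span_singleton]
    have h1 : ((idealNu I : ℕ) : 𝓞 K) = algebraMap ℤ (𝓞 K) (idealNu I : ℤ) := by simp
    rw [h1, Algebra.norm_algebraMap, NumberField.RingOfIntegers.rank, finrank_K]
    simp [Int.natAbs_pow]
  rwa [hq] at this

/-- Monotonicity: `I ≤ J ⇒ ν(J) ∣ ν(I)`. [folklore] -/
theorem idealNu_dvd_of_le {I J : Ideal (𝓞 K)} (h : I ≤ J) : idealNu J ∣ idealNu I := by
  have hm : ((idealNu I : ℤ) : 𝓞 K) ∈ J := by rw [Int.cast_natCast]; exact h (idealNu_mem I)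
  have := (intCast_mem_iff_idealNu_dvd J _).mp hm
  exact_mod_cast this

/-- `ν((1)) = 1`. [folklore] -/
theorem idealNu_top : idealNu (⊤ : Ideal (𝓞 K)) = 1 := by
  have h := idealNu_dvd_absNorm (⊤ : Ideal (𝓞 K))
  rw [Ideal.absNorm_top, Nat.dvd_one] at h
  exact h

/-! ### Prime ideals: the norm is a prime power -/

/-- The rational prime under a prime ideal, read off the norm. [folklore] -/
def underPrime (P : Ideal (𝓞 K)) : ℕ := (Ideal.absNorm P).minFac

/-- For a non-zero prime ideal, `N(P) = p^f` with `p = underPrime P` prime and `f ≥ 1` (the norm is the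
cardinality of the finite field `𝓞_K/P`; cf. `exists_absNorm_eq_prime_pow'` of
`HeathBrownCubicFLSequencesA`, not imported here). [folklore] -/
theorem absNorm_eq_underPrime_pow {P : Ideal (𝓞 K)} (hP : P.IsPrime) (hP0 : P ≠ ⊥) :
    (underPrime P).Prime ∧ ∃ f : ℕ, 0 < f ∧ Ideal.absNorm P = underPrime P ^ f := by
  classical
  haveI : P.IsMaximal := hP.isMaximal hP0
  letI : Field (𝓞 K ⧸ P) := Ideal.Quotient.field P
  haveI : Finite (𝓞 K ⧸ P) := Ideal.finiteQuotientOfFreeOfNeBot P hP0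
  letI : Fintype (𝓞 K ⧸ P) := Fintype.ofFinite _
  obtain ⟨q, _, n, hq, hcard⟩ := FiniteField.card' (𝓞 K ⧸ P)
  have hN : Ideal.absNorm P = q ^ (n : ℕ) := by
    rw [Ideal.absNorm_apply, Submodule.cardQuot_apply, Nat.card_eq_fintype_card, hcard]
  have hmin : underPrime P = q := by
    rw [underPrime, hN, Nat.pow_minFac n.pos.ne', hq.minFac_eq]
  rw [hmin]
  exact ⟨hq, n, n.pos, hN⟩


/-! ### `τ` and `ν` on finite products -/

/-- `τ(∏ J_i) ≤ ∏ τ(J_i)` over a finset (Lemma 4.3 iterated). [cite: HeathBrownActa2001, Lemma 4.3] -/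
theorem idealDivisorCount_finset_prod_le {ι : Type*} (s : Finset ι) (f : ι → Ideal (𝓞 K))
    (hf : ∀ i ∈ s, f i ≠ ⊥) :
    idealDivisorCount (∏ i ∈ s, f i) ≤ ∏ i ∈ s, idealDivisorCount (f i) := by
  classical
  induction s using Finset.induction_on with
  | empty =>
    simp only [prod_empty]
    unfold idealDivisorCount
    refine (card_le_card (t := {⊤}) fun D hD => ?_).trans (card_singleton _).le
    rw [mem_filter] at hD
    rw [mem_singleton]
    exact Ideal.isUnit_iff.mp (isUnit_of_dvd_one hD.2)
  | insert a s ha ih =>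
    have hfa : f a ≠ ⊥ := hf a (mem_insert_self a s)
    have hf' : ∀ i ∈ s, f i ≠ ⊥ := fun i hi => hf i (mem_insert_of_mem hi)
    have hs0 : ∏ i ∈ s, f i ≠ ⊥ := prod_ne_zero_iff.mpr hf'
    rw [prod_insert ha, prod_insert ha]
    exact (idealDivisorCount_mul_le hfa hs0).trans (Nat.mul_le_mul_left _ (ih hf'))

/-- Pairwise coprime natural numbers dividing `n` have their product dividing `n`. [folklore] -/
theorem finset_prod_dvd_of_coprime {ι : Type*} (s : Finset ι) (g : ι → ℕ) {n : ℕ}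
    (hdvd : ∀ i ∈ s, g i ∣ n) (hcop : ∀ i ∈ s, ∀ j ∈ s, i ≠ j → Nat.Coprime (g i) (g j)) :
    ∏ i ∈ s, g i ∣ n := by
  classical
  induction s using Finset.induction_on with
  | empty => simp
  | insert a s ha ih =>
    rw [prod_insert ha]
    have h1 : g a ∣ n := hdvd a (mem_insert_self a s)
    have h2 : ∏ i ∈ s, g i ∣ n := ih (fun i hi => hdvd i (mem_insert_of_mem hi))
      (fun i hi j hj hij => hcop i (mem_insert_of_mem hi) j (mem_insert_of_mem hj) hij)
    have h3 : Nat.Coprime (g a) (∏ i ∈ s, g i) :=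
      Nat.Coprime.prod_right fun i hi => hcop a (mem_insert_self a s) i (mem_insert_of_mem hi)
        (fun h => ha (h ▸ hi))
    exact h3.mul_dvd_of_dvd_of_dvd h1 h2

/-- The norm of a product of powers of prime ideals above `p` is a power of `p`. [folklore] -/
theorem exists_absNorm_prod_pow_eq_pow (p : ℕ) (e : Ideal (𝓞 K) → ℕ) :
    ∀ s : Finset (Ideal (𝓞 K)), (∀ P ∈ s, ∃ f : ℕ, Ideal.absNorm P = p ^ f) →
      ∃ m : ℕ, Ideal.absNorm (∏ P ∈ s, P ^ e P) = p ^ m := by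
  classical
  intro s
  induction s using Finset.induction_on with
  | empty => intro _; exact ⟨0, by simp⟩
  | insert P s hP ih =>
    intro h
    obtain ⟨m, hm⟩ := ih fun Q hQ => h Q (mem_insert_of_mem hQ)
    obtain ⟨f, hf⟩ := h P (mem_insert_self P s)
    refine ⟨f * e P + m, ?_⟩
    rw [prod_insert hP, map_mul, map_pow, hm, hf, ← pow_mul, ← pow_add]

/-! ### The `p`-primary parts of an ideal -/

open scoped Classical in
/-- The `p`-primary part `I_p = ∏_{P ∣ I, P above p} P^{v_P(I)}` of a non-zero ideal. [folklore] -/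
def pPart (p : ℕ) (I : Ideal (𝓞 K)) : Ideal (𝓞 K) :=
  ∏ P ∈ (normalizedFactors I).toFinset.filter (fun P => underPrime P = p),
    P ^ (normalizedFactors I).count P

/-- Members of `normalizedFactors I` are non-zero prime ideals. [folklore] -/
theorem isPrime_of_mem_normalizedFactors {I P : Ideal (𝓞 K)} (hP : P ∈ normalizedFactors I) :
    P.IsPrime ∧ P ≠ ⊥ := by
  have h := prime_of_normalized_factor P hP
  exact ⟨Ideal.isPrime_of_prime h, h.ne_zero⟩

open scoped Classical in
/-- `I_p ∣ I`. [folklore] -/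
theorem pPart_dvd {I : Ideal (𝓞 K)} (hI : I ≠ ⊥) (p : ℕ) : pPart p I ∣ I := by
  conv_rhs => rw [← Ideal.prod_normalizedFactors_eq_self hI, Finset.prod_multiset_count]
  exact Finset.prod_dvd_prod_of_subset _ _ _ (filter_subset _ _)

/-- `I_p ≠ 0`. [folklore] -/
theorem pPart_ne_bot {I : Ideal (𝓞 K)} (hI : I ≠ ⊥) (p : ℕ) : pPart p I ≠ ⊥ := by
  intro h
  have := pPart_dvd hI p
  rw [h] at this
  exact hI (zero_dvd_iff.mp this)

open scoped Classical in
/-- `N(I_p)` is a power of `p`. [folklore] -/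
theorem exists_absNorm_pPart_eq_pow (I : Ideal (𝓞 K)) (p : ℕ) :
    ∃ m : ℕ, Ideal.absNorm (pPart p I) = p ^ m := by
  unfold pPart
  refine exists_absNorm_prod_pow_eq_pow p _ _ fun P hP => ?_
  rw [mem_filter, Multiset.mem_toFinset] at hP
  obtain ⟨hpr, hP0⟩ := isPrime_of_mem_normalizedFactors hP.1
  obtain ⟨-, f, -, hf⟩ := absNorm_eq_underPrime_pow hpr hP0
  exact ⟨f, by rw [hf, hP.2]⟩

open scoped Classical in
/-- For `p` not prime, `I_p = 1` (every `underPrime` is prime). [folklore] -/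
theorem pPart_eq_one_of_not_prime (I : Ideal (𝓞 K)) {p : ℕ} (hp : ¬p.Prime) : pPart p I = 1 := by
  unfold pPart
  rw [filter_eq_empty_iff.mpr, prod_empty]
  intro P hP heq
  obtain ⟨hpr, hP0⟩ := isPrime_of_mem_normalizedFactors (Multiset.mem_toFinset.mp hP)
  exact hp (heq ▸ (absNorm_eq_underPrime_pow hpr hP0).1)

open scoped Classical in
/-- **`I = ∏_p I_p`** over any finite set of natural numbers containing the primes under the prime
factors of `I` (the other factors are `1`). [folklore] -/
theorem prod_pPart_eq {I : Ideal (𝓞 K)} (hI : I ≠ ⊥) {S : Finset ℕ}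
    (hS : ∀ P ∈ normalizedFactors I, underPrime P ∈ S) : ∏ p ∈ S, pPart p I = I := by
  unfold pPart
  rw [Finset.prod_fiberwise_of_maps_to (g := underPrime)
    (fun P hP => hS P (Multiset.mem_toFinset.mp hP))]
  rw [← Finset.prod_multiset_count, Ideal.prod_normalizedFactors_eq_self hI]

/-- The primes under the prime factors of `I ≠ 0` are `≤ N(I)`. [folklore] -/
theorem underPrime_le_absNorm {I P : Ideal (𝓞 K)} (hI : I ≠ ⊥) (hP : P ∈ normalizedFactors I) :
    (underPrime P).Prime ∧ underPrime P ≤ Ideal.absNorm I := by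
  obtain ⟨hpr, hP0⟩ := isPrime_of_mem_normalizedFactors hP
  obtain ⟨hq, f, hf, hN⟩ := absNorm_eq_underPrime_pow hpr hP0
  refine ⟨hq, ?_⟩
  have hdvd : Ideal.absNorm P ∣ Ideal.absNorm I :=
    Ideal.absNorm_dvd_absNorm_of_le (Ideal.le_of_dvd (dvd_of_mem_normalizedFactors hP))
  have hNI : Ideal.absNorm I ≠ 0 := by rwa [Ne, Ideal.absNorm_eq_zero_iff]
  calc underPrime P ≤ Ideal.absNorm P := by
        rw [hN]; exact Nat.le_self_pow hf.ne' _
    _ ≤ Ideal.absNorm I := Nat.le_of_dvd (Nat.pos_of_ne_zero hNI) hdvd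

/-- The weight `h(J) = τ(J)^c/ν(J)`. [cite: HeathBrownActa2001, §4 p. 24] -/
def nuWeight (c : ℕ) (J : Ideal (𝓞 K)) : ℝ := (idealDivisorCount J : ℝ) ^ c / idealNu J

/-- `h ≥ 0`. [folklore] -/
theorem nuWeight_nonneg (c : ℕ) (J : Ideal (𝓞 K)) : 0 ≤ nuWeight c J := by
  unfold nuWeight; positivity

/-- `h((1)) = 1`. [folklore] -/
theorem nuWeight_top (c : ℕ) : nuWeight c (⊤ : Ideal (𝓞 K)) = 1 := by
  unfold nuWeight
  have h1 : idealDivisorCount (⊤ : Ideal (𝓞 K)) = 1 := by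
    have := one_le_idealDivisorCount (show (⊤ : Ideal (𝓞 K)) ≠ ⊥ from top_ne_bot)
    have h2 : idealDivisorCount (⊤ : Ideal (𝓞 K)) ≤ 1 := by
      classical
      unfold idealDivisorCount
      refine (card_le_card (t := {⊤}) fun D hD => ?_).trans (card_singleton _).le
      rw [mem_filter] at hD
      rw [mem_singleton]
      exact Ideal.isUnit_iff.mp (isUnit_of_dvd_one (by rw [Ideal.one_eq_top]; exact hD.2))
    omega
  rw [h1, idealNu_top]; simp

/-- **Sub-multiplicativity over the `p`-parts: `h(I) ≤ ∏_p h(I_p)`** — `τ(I) ≤ ∏ τ(I_p)` (Lemma 4.3)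
and `∏ ν(I_p) ∣ ν(I)` (the `ν(I_p) ∣ N(I_p) = p^{m_p}` are pairwise coprime divisors of `ν(I)`).
[cite: HeathBrownActa2001, §4 p. 24] -/
theorem nuWeight_le_prod {I : Ideal (𝓞 K)} (hI : I ≠ ⊥) (c : ℕ) {S : Finset ℕ}
    (hS : ∀ P ∈ normalizedFactors I, underPrime P ∈ S) :
    nuWeight c I ≤ ∏ p ∈ S, nuWeight c (pPart p I) := by
  have hprod := prod_pPart_eq hI hS
  -- `τ`
  have hτ : (idealDivisorCount I : ℝ) ^ c ≤ ∏ p ∈ S, (idealDivisorCount (pPart p I) : ℝ) ^ c := by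
    rw [prod_pow]
    have h := idealDivisorCount_finset_prod_le S (fun p => pPart p I) fun p _ => pPart_ne_bot hI p
    rw [hprod] at h
    exact_mod_cast Nat.pow_le_pow_left h c
  -- `ν`
  have hν : ∏ p ∈ S, idealNu (pPart p I) ∣ idealNu I := by
    refine finset_prod_dvd_of_coprime S _ (fun p _ => idealNu_dvd_of_le (Ideal.le_of_dvd (pPart_dvd hI p)))
      ?_
    intro p _ q _ hpq
    obtain ⟨m, hm⟩ := exists_absNorm_pPart_eq_pow I p
    obtain ⟨n, hn⟩ := exists_absNorm_pPart_eq_pow I q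
    have hdp : idealNu (pPart p I) ∣ p ^ m := hm ▸ idealNu_dvd_absNorm _
    have hdq : idealNu (pPart q I) ∣ q ^ n := hn ▸ idealNu_dvd_absNorm _
    by_cases hp : p.Prime
    · by_cases hq : q.Prime
      · exact ((Nat.coprime_pow_primes m n hp hq hpq).coprime_dvd_left hdp).coprime_dvd_right hdq
      · rw [pPart_eq_one_of_not_prime I hq, Ideal.one_eq_top, idealNu_top]
        exact Nat.coprime_one_right _
    · rw [pPart_eq_one_of_not_prime I hp, Ideal.one_eq_top, idealNu_top]
      exact Nat.coprime_one_left _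
  have hνpos : 0 < idealNu I := idealNu_pos hI
  have hνparts : ∀ p ∈ S, 0 < idealNu (pPart p I) := fun p _ => idealNu_pos (pPart_ne_bot hI p)
  have hνle : ((∏ p ∈ S, idealNu (pPart p I) : ℕ) : ℝ) ≤ idealNu I := by
    exact_mod_cast Nat.le_of_dvd hνpos hν
  unfold nuWeight
  rw [prod_div_distrib]
  have hden : (0 : ℝ) < ∏ p ∈ S, (idealNu (pPart p I) : ℝ) :=
    prod_pos fun p hp => by exact_mod_cast hνparts p hp
  calc (idealDivisorCount I : ℝ) ^ c / idealNu I
      ≤ (∏ p ∈ S, (idealDivisorCount (pPart p I) : ℝ) ^ c) / idealNu I :=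
        div_le_div_of_nonneg_right hτ (by positivity)
    _ ≤ (∏ p ∈ S, (idealDivisorCount (pPart p I) : ℝ) ^ c) / ∏ p ∈ S, (idealNu (pPart p I) : ℝ) := by
        refine div_le_div_of_nonneg_left (by positivity) hden ?_
        push_cast at hνle ⊢
        exact hνle


/-! ### The local factors: ideals of `p`-power norm -/

/-- The ratio `r = 2^{-1/3}` and the constant `K(c) = ∑_{j ≥ 0} (j+2)^{4c+3} r^{j+1}`. [folklore] -/
def nuRatio : ℝ := (2 : ℝ) ^ (-(1 / 3 : ℝ))

/-- `0 < r < 1`. [folklore] -/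
theorem nuRatio_pos_lt_one : 0 < nuRatio ∧ nuRatio < 1 := by
  unfold nuRatio
  refine ⟨Real.rpow_pos_of_pos two_pos _, ?_⟩
  exact Real.rpow_lt_one_of_one_lt_of_neg one_lt_two (by norm_num)

/-- `r^m = 2^{-m/3}`. [folklore] -/
theorem nuRatio_pow (m : ℕ) : nuRatio ^ m = (2 : ℝ) ^ (-(m : ℝ) / 3) := by
  unfold nuRatio
  rw [← Real.rpow_mul_natCast zero_le_two]
  congr 1; ring

/-- The summand of the constant `K(c)`. [folklore] -/
def nuTerm (c j : ℕ) : ℝ := ((j : ℝ) + 2) ^ (4 * c + 3) * nuRatio ^ (j + 1)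

/-- Summability of `(j+2)^B r^{j+1}`. [folklore] -/
theorem summable_nuTerm (c : ℕ) : Summable (nuTerm c) := by
  obtain ⟨hr0, hr1⟩ := nuRatio_pos_lt_one
  have hnorm : ‖nuRatio‖ < 1 := by rw [Real.norm_of_nonneg hr0.le]; exact hr1
  have h := summable_pow_mul_geometric_of_norm_lt_one (4 * c + 3) hnorm
  -- shift by two and divide by `r`
  have h2 : Summable (fun j : ℕ => ((j + 2 : ℕ) : ℝ) ^ (4 * c + 3) * nuRatio ^ (j + 2)) :=
    (summable_nat_add_iff 2).mpr h
  have h3 : Summable (fun j : ℕ => nuRatio⁻¹ * (((j + 2 : ℕ) : ℝ) ^ (4 * c + 3) * nuRatio ^ (j + 2))) :=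
    h2.mul_left _
  refine h3.congr fun j => ?_
  unfold nuTerm
  push_cast
  field_simp
  ring

/-- The constant `K(c)`. [folklore] -/
def nuConst (c : ℕ) : ℝ := ∑' j : ℕ, nuTerm c j

/-- `K(c) ≥ 0` and partial sums are bounded by it. [folklore] -/
theorem sum_nuTerm_le (c M : ℕ) : ∑ j ∈ range M, nuTerm c j ≤ nuConst c :=
  (summable_nuTerm c).sum_le_tsum (range M) fun j _ => by
    unfold nuTerm; have := nuRatio_pos_lt_one.1; positivity

/-- `K(c) ≥ 0`. [folklore] -/
theorem nuConst_nonneg (c : ℕ) : 0 ≤ nuConst c :=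
  le_trans (by simp) (sum_nuTerm_le c 0)

/-- **`ν(J) ≥ p·2^{m/3−1}` for `N(J) = p^m`, `m ≥ 1`**: `1/ν(J) ≤ 2r^m/p`. Indeed `p^m = N(J) ∣ ν(J)³`
gives `p ∣ ν(J)` and `ν(J) ≥ p^{m/3}` (p. 25: "`N(I₁) ∣ ν(I₁)³` … It follows that
`ν(I₁)ν(I₂) ≥ p^{m/3}`. We also have `ν(I₁)ν(I₂) ≥ p` for `m ≥ 1`"). [cite: HeathBrownActa2001, §4 p. 25] -/
theorem inv_idealNu_le {J : Ideal (𝓞 K)} (hJ : J ≠ ⊥) {p m : ℕ} (hp : p.Prime) (hm : 1 ≤ m)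
    (hN : Ideal.absNorm J = p ^ m) :
    (1 : ℝ) / idealNu J ≤ 2 * nuRatio ^ m / p := by
  set ν := idealNu J with hν
  have hνpos : 0 < ν := idealNu_pos hJ
  have hν' : (0 : ℝ) < ν := by exact_mod_cast hνpos
  have hp2 : (2 : ℝ) ≤ p := by exact_mod_cast hp.two_le
  have hp0 : (0 : ℝ) < p := by linarith
  have hdvd : p ^ m ∣ ν ^ 3 := hN ▸ absNorm_dvd_idealNu_pow J
  -- (a) `p ≤ ν`
  have hpν : (p : ℝ) ≤ ν := by
    have h1 : p ∣ ν ^ 3 := (dvd_pow_self p (by omega)).trans hdvd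
    have h2 : p ∣ ν := hp.dvd_of_dvd_pow h1
    exact_mod_cast Nat.le_of_dvd hνpos h2
  -- (b) `p^{m/3} ≤ ν`
  have hpm : (p : ℝ) ^ ((m : ℝ) / 3) ≤ ν := by
    have h1 : ((p ^ m : ℕ) : ℝ) ≤ ((ν ^ 3 : ℕ) : ℝ) := by
      exact_mod_cast Nat.le_of_dvd (pow_pos hνpos 3) hdvd
    push_cast at h1
    have h2 : ((p : ℝ) ^ m) ^ ((1 : ℝ) / 3) ≤ ((ν : ℝ) ^ 3) ^ ((1 : ℝ) / 3) :=
      Real.rpow_le_rpow (by positivity) h1 (by norm_num)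
    rw [← Real.rpow_natCast, ← Real.rpow_mul hp0.le, ← Real.rpow_natCast (ν : ℝ) 3,
      ← Real.rpow_mul hν'.le] at h2
    norm_num at h2
    rwa [show (m : ℝ) * (1 / 3) = (m : ℝ) / 3 by ring] at h2
  -- `p · 2^{m/3 - 1} ≤ ν`
  have key : (p : ℝ) * (2 : ℝ) ^ ((m : ℝ) / 3 - 1) ≤ ν := by
    rcases le_or_gt (m : ℝ) 3 with h3 | h3
    · have : (2 : ℝ) ^ ((m : ℝ) / 3 - 1) ≤ 1 :=
        Real.rpow_le_one_of_one_le_of_nonpos one_le_two (by linarith)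
      calc (p : ℝ) * (2 : ℝ) ^ ((m : ℝ) / 3 - 1) ≤ p * 1 := by gcongr
        _ = p := mul_one _
        _ ≤ ν := hpν
    · have hexp : 0 ≤ (m : ℝ) / 3 - 1 := by linarith
      calc (p : ℝ) * (2 : ℝ) ^ ((m : ℝ) / 3 - 1) ≤ p * (p : ℝ) ^ ((m : ℝ) / 3 - 1) := by
            gcongr
        _ = (p : ℝ) ^ ((m : ℝ) / 3) := by
            rw [← Real.rpow_one_add' hp0.le (by linarith)]; congr 1; ring
        _ ≤ ν := hpm
  -- conclude: multiply `key` by `2 · 2^{-m/3}` and use `2^{m/3-1} · 2 · 2^{-m/3} = 1`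
  have hid : (2 : ℝ) ^ ((m : ℝ) / 3 - 1) * (2 * (2 : ℝ) ^ (-(m : ℝ) / 3)) = 1 := by
    rw [mul_left_comm, ← Real.rpow_add two_pos, show (m : ℝ) / 3 - 1 + -(m : ℝ) / 3 = -1 by ring,
      Real.rpow_neg_one]
    norm_num
  rw [nuRatio_pow, div_le_div_iff₀ hν' hp0, one_mul]
  calc (p : ℝ) = p * ((2 : ℝ) ^ ((m : ℝ) / 3 - 1) * (2 * (2 : ℝ) ^ (-(m : ℝ) / 3))) := by
        rw [hid, mul_one]
    _ = (p * (2 : ℝ) ^ ((m : ℝ) / 3 - 1)) * (2 * (2 : ℝ) ^ (-(m : ℝ) / 3)) := by ring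
    _ ≤ ν * (2 * (2 : ℝ) ^ (-(m : ℝ) / 3)) := mul_le_mul_of_nonneg_right key (by positivity)
    _ = 2 * (2 : ℝ) ^ (-(m : ℝ) / 3) * ν := by ring


open scoped Classical in
/-- **The ideals of norm `p^m`, `m ≥ 1`, contribute `≤ (2/p)(m+1)^{4c+3} r^m`**: there are at most
`τ(p^m)³ = (m+1)³` of them, each with `τ(J) ≤ τ(p^m)⁴ = (m+1)⁴` and `1/ν(J) ≤ 2r^m/p` (p. 25: "there are
at most `(m+1)⁵` pairs `I₁, I₂`, and `τ(I₁I₂) ≤ (m+1)³` for each pair"). [cite: HeathBrownActa2001, §4 p. 25] -/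
theorem sum_nuWeight_norm_eq_le (c : ℕ) {p m : ℕ} (hp : p.Prime) (hm : 1 ≤ m) (S : Finset (Ideal (𝓞 K))) :
    ∑ J ∈ S.filter (fun J => Ideal.absNorm J = p ^ m), nuWeight c J ≤
      2 / p * ((m : ℝ) + 1) ^ (4 * c + 3) * nuRatio ^ m := by
  have hp0 : (0 : ℝ) < p := by exact_mod_cast hp.pos
  have hr := nuRatio_pos_lt_one.1
  set F := S.filter (fun J => Ideal.absNorm J = p ^ m) with hF
  have hpm : p ^ m ≠ 0 := pow_ne_zero _ hp.ne_zero
  -- each term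
  have hterm : ∀ J ∈ F, nuWeight c J ≤ ((m : ℝ) + 1) ^ (4 * c) * (2 * nuRatio ^ m / p) := by
    intro J hJ
    rw [hF, mem_filter] at hJ
    have hJ0 : J ≠ ⊥ := by
      intro h; rw [h, Ideal.absNorm_bot] at hJ; exact hpm hJ.2.symm
    have hτ : idealDivisorCount J ≤ (m + 1) ^ 4 := by
      have h := idealDivisorCount_le_sigma_zero_pow_four hJ0
      rwa [hJ.2, ArithmeticFunction.sigma_zero_apply_prime_pow hp] at h
    have hτc : (idealDivisorCount J : ℝ) ^ c ≤ ((m : ℝ) + 1) ^ (4 * c) := by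
      have : (idealDivisorCount J : ℝ) ≤ ((m : ℝ) + 1) ^ 4 := by exact_mod_cast hτ
      calc (idealDivisorCount J : ℝ) ^ c ≤ (((m : ℝ) + 1) ^ 4) ^ c :=
            pow_le_pow_left₀ (by positivity) this c
        _ = ((m : ℝ) + 1) ^ (4 * c) := by rw [← pow_mul]
    have hν := inv_idealNu_le hJ0 hp hm hJ.2
    unfold nuWeight
    rw [div_eq_mul_one_div]
    exact mul_le_mul hτc hν (by positivity) (by positivity)
  -- number of terms
  have hcard : #F ≤ (m + 1) ^ 3 := by
    have hsub : F ⊆ (idealsLE (p ^ m)).filter (fun D => Ideal.absNorm D = p ^ m) := by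
      intro J hJ
      rw [hF, mem_filter] at hJ
      rw [mem_filter, mem_idealsLE]
      exact ⟨hJ.2.le, hJ.2⟩
    have heq : #((idealsLE (p ^ m)).filter (fun D => Ideal.absNorm D = p ^ m)) =
        LFunctions.idealNormCount K (p ^ m) :=
      card_filter_absNorm_eq fun D hD => by rw [mem_idealsLE, hD]
    calc #F ≤ #((idealsLE (p ^ m)).filter (fun D => Ideal.absNorm D = p ^ m)) := card_le_card hsub
      _ = LFunctions.idealNormCount K (p ^ m) := heq
      _ ≤ σ 0 (p ^ m) ^ 3 := idealNormCount_le_sigma_zero_pow_three hpm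
      _ = (m + 1) ^ 3 := by rw [ArithmeticFunction.sigma_zero_apply_prime_pow hp]
  calc ∑ J ∈ F, nuWeight c J ≤ ∑ J ∈ F, ((m : ℝ) + 1) ^ (4 * c) * (2 * nuRatio ^ m / p) :=
        sum_le_sum hterm
    _ = #F * (((m : ℝ) + 1) ^ (4 * c) * (2 * nuRatio ^ m / p)) := by rw [sum_const, nsmul_eq_mul]
    _ ≤ ((m + 1) ^ 3 : ℕ) * (((m : ℝ) + 1) ^ (4 * c) * (2 * nuRatio ^ m / p)) := by
        gcongr
    _ = 2 / p * ((m : ℝ) + 1) ^ (4 * c + 3) * nuRatio ^ m := by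
        push_cast; ring

open scoped Classical in
/-- The set of non-zero ideals of norm `≤ N` whose norm is a power of `p` (including `(1)`). [folklore] -/
def pPowerIdeals (p N : ℕ) : Finset (Ideal (𝓞 K)) :=
  ((idealsLE N).filter (· ≠ ⊥)).filter (fun J => ∃ m : ℕ, Ideal.absNorm J = p ^ m)

open scoped Classical in
/-- **The local factor at `p`: `∑_{J p-power norm ≤ N} h(J) ≤ 1 + (2/p) K(c)`**. [cite: HeathBrownActa2001, §4 p. 25] -/
theorem sum_pPowerIdeals_nuWeight_le (c : ℕ) {p : ℕ} (hp : p.Prime) (N : ℕ) :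
    ∑ J ∈ pPowerIdeals p N, nuWeight c J ≤ 1 + 2 / p * nuConst c := by
  have hp0 : (0 : ℝ) < p := by exact_mod_cast hp.pos
  set M := Nat.log p N with hM
  -- fibre decomposition by the exponent
  have hmaps : ∀ J ∈ pPowerIdeals p N, Nat.log p (Ideal.absNorm J) ∈ range (M + 1) := by
    intro J hJ
    simp only [pPowerIdeals, mem_filter, mem_idealsLE] at hJ
    rw [mem_range, Nat.lt_succ_iff]
    exact Nat.log_mono_right hJ.1.1
  rw [← sum_fiberwise_of_maps_to hmaps]
  -- the fibre over `m` is the set of ideals of norm exactly `p^m`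
  have hfib : ∀ m : ℕ, (pPowerIdeals p N).filter (fun J => Nat.log p (Ideal.absNorm J) = m) =
      (pPowerIdeals p N).filter (fun J => Ideal.absNorm J = p ^ m) := by
    intro m
    ext J
    simp only [pPowerIdeals, mem_filter]
    constructor
    · rintro ⟨⟨h1, k, hk⟩, h2⟩
      refine ⟨⟨h1, k, hk⟩, ?_⟩
      rw [hk, Nat.log_pow hp.one_lt] at h2
      rw [hk, h2]
    · rintro ⟨⟨h1, k, hk⟩, h2⟩
      refine ⟨⟨h1, k, hk⟩, ?_⟩
      rw [h2, Nat.log_pow hp.one_lt]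
  simp only [hfib]
  -- split off `m = 0`
  rw [Finset.range_eq_Ico, ← Finset.insert_Ico_add_one_left_eq_Ico (Nat.zero_lt_succ M),
    sum_insert (by simp)]
  refine add_le_add ?_ ?_
  · -- `m = 0`: only `J = (1)`
    have hsub : (pPowerIdeals p N).filter (fun J => Ideal.absNorm J = p ^ 0) ⊆ {⊤} := by
      intro J hJ
      rw [mem_filter, pow_zero] at hJ
      rw [mem_singleton]
      exact Ideal.absNorm_eq_one_iff.mp hJ.2
    calc ∑ J ∈ (pPowerIdeals p N).filter (fun J => Ideal.absNorm J = p ^ 0), nuWeight c J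
        ≤ ∑ J ∈ ({⊤} : Finset (Ideal (𝓞 K))), nuWeight c J :=
          sum_le_sum_of_subset_of_nonneg hsub fun J _ _ => nuWeight_nonneg c J
      _ = 1 := by rw [sum_singleton, nuWeight_top]
  · -- `m ≥ 1`
    calc ∑ m ∈ Ico (0 + 1) (M + 1), ∑ J ∈ (pPowerIdeals p N).filter (fun J => Ideal.absNorm J = p ^ m),
            nuWeight c J
        ≤ ∑ m ∈ Ico (0 + 1) (M + 1), 2 / p * ((m : ℝ) + 1) ^ (4 * c + 3) * nuRatio ^ m := by
          refine sum_le_sum fun m hm => ?_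
          rw [mem_Ico] at hm
          exact sum_nuWeight_norm_eq_le c hp (by omega) _
      _ = 2 / p * ∑ m ∈ Ico (0 + 1) (M + 1), ((m : ℝ) + 1) ^ (4 * c + 3) * nuRatio ^ m := by
          rw [mul_sum]; exact sum_congr rfl fun m _ => by ring
      _ = 2 / p * ∑ j ∈ range M, nuTerm c j := by
          congr 1
          rw [zero_add, Finset.sum_Ico_eq_sum_range]
          simp only [Nat.add_sub_cancel]
          refine sum_congr rfl fun j _ => ?_
          unfold nuTerm
          push_cast
          ring_nf
      _ ≤ 2 / p * nuConst c := by
          refine mul_le_mul_of_nonneg_left (sum_nuTerm_le c M) (by positivity)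


/-! ### The `ν`-weighted divisor sum: `∑_{0 < N(I) ≤ N} τ(I)^c/ν(I) ≪ (log N)^{2K(c)}` -/

open scoped Classical in
/-- The `p`-part of an ideal of norm `≤ N` is a `p`-power-norm ideal of norm `≤ N`. [folklore] -/
theorem pPart_mem_pPowerIdeals {I : Ideal (𝓞 K)} (hI : I ≠ ⊥) {N : ℕ} (hIN : Ideal.absNorm I ≤ N)
    (p : ℕ) : pPart p I ∈ pPowerIdeals p N := by
  simp only [pPowerIdeals, mem_filter, mem_idealsLE]
  refine ⟨⟨?_, pPart_ne_bot hI p⟩, exists_absNorm_pPart_eq_pow I p⟩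
  have hdvd := Ideal.absNorm_dvd_absNorm_of_le (Ideal.le_of_dvd (pPart_dvd hI p))
  have hNI : Ideal.absNorm I ≠ 0 := by rwa [Ne, Ideal.absNorm_eq_zero_iff]
  exact (Nat.le_of_dvd (Nat.pos_of_ne_zero hNI) hdvd).trans hIN

/-- Comparison of sums along an injection into a larger index set with non-negative terms. [folklore] -/
theorem sum_le_sum_of_injOn_nonneg {ι κ : Type*} [DecidableEq κ] (s : Finset ι) (t : Finset κ)
    (e : ι → κ) (f : ι → ℝ) (g : κ → ℝ) (he : Set.InjOn e s) (hst : ∀ i ∈ s, e i ∈ t)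
    (hg : ∀ j ∈ t, 0 ≤ g j) (hfg : ∀ i ∈ s, f i ≤ g (e i)) : ∑ i ∈ s, f i ≤ ∑ j ∈ t, g j := by
  calc ∑ i ∈ s, f i ≤ ∑ i ∈ s, g (e i) := sum_le_sum hfg
    _ = ∑ j ∈ s.image e, g j := (sum_image he).symm
    _ ≤ ∑ j ∈ t, g j :=
        sum_le_sum_of_subset_of_nonneg (image_subset_iff.mpr hst) fun j hj _ => hg j hj

/-- `1 + x ≤ exp x`, product form: `∏ (1 + a_i) ≤ exp(∑ a_i)` for `a_i ≥ 0`. [folklore] -/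
theorem prod_one_add_le_exp_sum {ι : Type*} (s : Finset ι) (a : ι → ℝ) (ha : ∀ i ∈ s, 0 ≤ a i) :
    ∏ i ∈ s, (1 + a i) ≤ Real.exp (∑ i ∈ s, a i) := by
  rw [Real.exp_sum]
  exact prod_le_prod (fun i hi => by linarith [ha i hi]) fun i _ => by
    have := Real.add_one_le_exp (a i); linarith

open scoped Classical in
/-- **The `ν`-weighted divisor sum over `K`** (the core of Heath-Brown's Lemma 4.6 for `α = 1`, pp. 24–25,
there via the Dirichlet series `f(σ) = ∑ τ(I)^{(6r+5)A}/(ν(I₁)ν(I₂)N(I)^σ) ≪ σ^{-c}`): for every `c`,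
`∑_{0 < N(I) ≤ N} τ(I)^c/ν(I) ≤ e^{8K} (log N)^{2K}` for `N ≥ 2`, `K = K(c)`.  Proof: `h(I) ≤ ∏_p h(I_p)`
(`nuWeight_le_prod`), the map `I ↦ (I_p)_{p ≤ N}` is injective, so the sum is at most
`∏_{p ≤ N} ∑_{J p-power norm} h(J) ≤ ∏_{p ≤ N} (1 + 2K/p) ≤ exp(2K ∑_{p≤N} 1/p) ≤ exp(2K(log log N + 4))`
(Mertens, `MertensBound.sum_inv_prime_le`). [cite: HeathBrownActa2001, Lemma 4.6] -/
theorem sum_nuWeight_le (c : ℕ) {N : ℕ} (hN : 2 ≤ N) :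
    ∑ I ∈ (idealsLE N).filter (· ≠ ⊥), nuWeight c I ≤
      Real.exp (8 * nuConst c) * Real.log N ^ (2 * nuConst c) := by
  set T := (idealsLE N).filter (· ≠ (⊥ : Ideal (𝓞 K))) with hT
  set Ps := Nat.primesLE N with hPs
  have hK := nuConst_nonneg c
  -- the index type of primes `≤ N`, the local sets and the map `I ↦ (I_p)_p`
  obtain ⟨t, ht⟩ : ∃ t : Ps → Finset (Ideal (𝓞 K)), ∀ q, t q = pPowerIdeals q.1 N :=
    ⟨fun q => pPowerIdeals q.1 N, fun _ => rfl⟩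
  obtain ⟨Φ, hΦ⟩ : ∃ Φ : Ideal (𝓞 K) → (Ps → Ideal (𝓞 K)), ∀ I q, Φ I q = pPart q.1 I :=
    ⟨fun I q => pPart q.1 I, fun _ _ => rfl⟩
  have hprimes : ∀ I ∈ T, ∀ P ∈ normalizedFactors I, underPrime P ∈ Ps := by
    intro I hI P hP
    rw [hT, mem_filter, mem_idealsLE] at hI
    obtain ⟨hq, hle⟩ := underPrime_le_absNorm hI.2 hP
    rw [hPs, Nat.mem_primesLE]
    exact ⟨hle.trans hI.1, hq⟩
  -- Step 1: `h(I) ≤ ∏_q h(Φ I q)`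
  have step1 : ∀ I ∈ T, nuWeight c I ≤ ∏ q : Ps, nuWeight c (Φ I q) := by
    intro I hI
    have hI0 : I ≠ ⊥ := (mem_filter.mp hI).2
    have h := nuWeight_le_prod hI0 c (hprimes I hI)
    rw [← Finset.prod_coe_sort Ps] at h
    refine h.trans (le_of_eq (prod_congr rfl fun q _ => by rw [hΦ]))
  -- Step 2: `Φ` maps `T` into the box `∏_q t q`
  have step2 : ∀ I ∈ T, Φ I ∈ Fintype.piFinset t := by
    intro I hI
    rw [hT, mem_filter, mem_idealsLE] at hI
    rw [Fintype.mem_piFinset]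
    intro q
    rw [hΦ, ht]
    exact pPart_mem_pPowerIdeals hI.2 hI.1 q.1
  -- Step 3: `Φ` is injective on `T`
  have step3 : Set.InjOn Φ T := by
    intro I hI I' hI' hII'
    have hI0 : I ≠ ⊥ := (mem_filter.mp hI).2
    have hI0' : I' ≠ ⊥ := (mem_filter.mp hI').2
    rw [← prod_pPart_eq hI0 (hprimes I hI), ← prod_pPart_eq hI0' (hprimes I' hI'),
      ← Finset.prod_coe_sort Ps, ← Finset.prod_coe_sort Ps]
    refine prod_congr rfl fun q _ => ?_
    have := congrFun hII' q
    rwa [hΦ, hΦ] at this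
  -- Step 4: sum ≤ product of local factors
  have hnonneg : ∀ F : Ps → Ideal (𝓞 K), 0 ≤ ∏ q : Ps, nuWeight c (F q) :=
    fun F => prod_nonneg fun q _ => nuWeight_nonneg c _
  have step4 : ∑ I ∈ T, nuWeight c I ≤ ∏ q : Ps, ∑ J ∈ t q, nuWeight c J := by
    calc ∑ I ∈ T, nuWeight c I ≤ ∑ F ∈ Fintype.piFinset t, ∏ q : Ps, nuWeight c (F q) :=
          sum_le_sum_of_injOn_nonneg T _ Φ (fun I => nuWeight c I)
            (fun F => ∏ q : Ps, nuWeight c (F q)) step3 step2 (fun F _ => hnonneg F) step1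
      _ = ∏ q : Ps, ∑ J ∈ t q, nuWeight c J := (Finset.prod_univ_sum t _).symm
  -- Step 5: local factors and Mertens
  have step5 : ∏ q : Ps, ∑ J ∈ t q, nuWeight c J ≤ ∏ p ∈ Ps, (1 + 2 * nuConst c / p) := by
    rw [← Finset.prod_coe_sort Ps (fun p => 1 + 2 * nuConst c / p)]
    refine prod_le_prod (fun q _ => sum_nonneg fun J _ => nuWeight_nonneg c J) fun q _ => ?_
    have hq : q.1.Prime := (Nat.mem_primesLE.mp q.2).2
    rw [ht]
    calc ∑ J ∈ pPowerIdeals q.1 N, nuWeight c J ≤ 1 + 2 / q.1 * nuConst c :=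
          sum_pPowerIdeals_nuWeight_le c hq N
      _ = 1 + 2 * nuConst c / q.1 := by ring
  have step6 : ∏ p ∈ Ps, (1 + 2 * nuConst c / p) ≤
      Real.exp (2 * nuConst c * (Real.log (Real.log N) + 4)) := by
    refine (prod_one_add_le_exp_sum Ps _ fun p _ => by positivity).trans ?_
    rw [Real.exp_le_exp]
    have hM := Literature.NumberTheory.LFunctions.MertensBound.sum_inv_prime_le N hN
    calc ∑ p ∈ Ps, 2 * nuConst c / (p : ℝ) = 2 * nuConst c * ∑ p ∈ Ps, (1 : ℝ) / p := by
          rw [mul_sum]; exact sum_congr rfl fun p _ => by ring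
      _ ≤ 2 * nuConst c * (Real.log (Real.log N) + 4) :=
          mul_le_mul_of_nonneg_left hM (by positivity)
  have hN' : (2 : ℝ) ≤ N := by exact_mod_cast hN
  have hlogpos : 0 < Real.log N := Real.log_pos (by linarith)
  calc ∑ I ∈ T, nuWeight c I ≤ ∏ q : Ps, ∑ J ∈ t q, nuWeight c J := step4
    _ ≤ ∏ p ∈ Ps, (1 + 2 * nuConst c / p) := step5
    _ ≤ Real.exp (2 * nuConst c * (Real.log (Real.log N) + 4)) := step6
    _ = Real.exp (8 * nuConst c) * Real.log N ^ (2 * nuConst c) := by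
        rw [Real.rpow_def_of_pos hlogpos, ← Real.exp_add]
        congr 1; ring

open scoped Classical in
/-- The `ν`-weighted divisor sum in the shape `∃ C e ≥ 0, ∑_{0 < N(I) ≤ N} τ(I)^c/ν(I) ≤ C (log N)^e`
(`N ≥ 2`). [cite: HeathBrownActa2001, Lemma 4.6] -/
theorem exists_sum_nuWeight_le (c : ℕ) :
    ∃ C e : ℝ, 0 < C ∧ 0 ≤ e ∧ ∀ N : ℕ, 2 ≤ N →
      ∑ I ∈ (idealsLE N).filter (· ≠ ⊥), (idealDivisorCount I : ℝ) ^ c / idealNu I ≤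
        C * Real.log N ^ e :=
  ⟨Real.exp (8 * nuConst c), 2 * nuConst c, Real.exp_pos _,
    mul_nonneg zero_le_two (nuConst_nonneg c), fun _ hN => sum_nuWeight_le c hN⟩

end Literature.NumberTheory.Sieve.CubicSieve

end
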